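import Summits.QuantumFields.BalabanUV.Gaps.D1IndexSymmetryDictionary

/-!
# `BalabanUV.Gaps.D1WardPinsBorderWeight` — cell pub-balaban-gaps, row (D1), seat g1-p1: ON THE β-LEAD's PINNED FAMILY THE WARD BINDER `hW` (5.9) PINS THE BORDER WEIGHT —
# the step kernels are AFFINE in `cB` ENTRYWISE, so every moment is affine in `cB`; two Ward-compatible border weights at one level force the unit border tower's zeroth moments to
# vanish there; if one of them is nonzero (Engine C, SIGMA-T1 §3.2: `Σ_z P₀(0,1,z) = −1.2018e-8` at `Lc = 3`, level 0 — a float reading, zero weight) then AT MOST ONE border weight per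
# `(r; c⃗; cE₂; Tc)` admits `hW` at that level, and it is given by an explicit ratio of zeroth moments

HONEST FRAMING (cell rule, page 1 of everything): [folklore] kernel algebra BY NAME — GEN 12's `D1PinnedResponseTowers.TbalOf_JsBalAn1_dataDiff` ∕ `T2Of_border_affine`, gan24's `Lin4Additive.vsym_smul`,
an2's `KernelReflection.tadpole_smul`, an1's `PolarizationSign.tsum_eq_zero_of_ward` ∕ `OddMoments.summable_self`, GEN 14's `momentSummable_flipK_TbalOf`.  `hW` is a HYPOTHESIS about a member
of the cells' OWN pinned family `JsBalAn1(r; cE cVH cΛ; cE₂; cB; Tc)` (the β-lead's candidate literal; (P6) — which member is print's — undecided); the file records what that hypothesis does to the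
family's free parameter `cB`, AS ALGEBRA.  The only number quoted (Engine C's zeroth moment of the border tower) is a float64 reading of zero classification weight, cited in docstrings only —
no hypothesis of any theorem depends on it.  Nothing of Bałaban's asserted ((5.9) is PRINTED for Bałaban's `Π` [Balaban1987RG1 p. 293] and holds there by gauge invariance); NO coefficient
computed or signed; (D1) NOT discharged; 0∕4 row-D1 binders; NOT `BetaPertH`, NOT continuum, NOT Clay.
HONEST DEPENDENCY (b2b cell, verbatim): «continuum YM on T⁴ ⇐ BetaPertH ∧ nine spine estimates (0/9 proved); BetaPertH ⇐ (D1) ∧ (D4) ∧ CAP+tail; G-an2-4 gates asym, D1 and NE2/3/4.»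

CONTENT (all [folklore]; no `def`, 0 sorry): §1 generic zeroth-moment bookkeeping (`zerothMoment_affine`, `eq_zero_of_affine_pair`); §2 **`TbalOf_JsBalAn1_border_affine`** (ENTRYWISE: `T_j(cB) = T_j(0) +
cB·(T_j(1) − T_j(0))`, every root, colour triple, `cE₂`, table, level, entry), `unitBorder_colour_free` (the unit border tower `T_j(1) − T_j(0)` is the SAME kernel for every colour triple), `zerothMoment_flipK_TbalOf_JsBalAn1_border_affine`,
`firstMoment_flipK_TbalOf_JsBalAn1_border_affine`; §3 `unitBorder_zerothMoment_colour_free`, **`unitBorder_zerothMoment_eq_zero_of_ward_pair`** (two DIFFERENT Ward-compatible border weights at level `j` ⟹ the unit border tower `T_j(1) − T_j(0)` has all zeroth moments zero at level `j`,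
and then so has EVERY member `T_j(cB″)`: `zerothMoment_eq_zero_all_of_ward_pair`), **`borderWeight_eq_of_ward`** (under `hW` at level `j`: `cB · m₀(unit border; c,e) = −m₀(T_j(0); c,e)` for every
channel), **`borderWeight_unique_of_ward`** (if some zeroth moment of the unit border tower is nonzero at level `j`, at most ONE border weight admits `hW` at level `j`).

Provenance: cell pub-balaban-gaps, seat g1-p1 GEN 15 (prover-pub-balaban-gaps-g1-p1-g15-0), 2026-08-25; imports `Gaps/D1IndexSymmetryDictionary` (p389565 ✓) only; no existing file touched.
-/

noncomputable section

open Literature.MathematicalPhysics.QuantumFieldTheory Balaban1983to89 Balaban1983to89.Beta Filter Topology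
open ExpKernelCalculus (tadpole)
open OneStepResolventKernel (JetData)
open OneStepKernelFamily (KInvStep TbalOf flipK)
open PolarizationSign (WardTransversal AxisReflectionCovariant MomentSummable tsum_eq_zero_of_ward)
open OddMoments (zerothMoment firstMoment summable_self summable_mul_coord firstMoment_eq_zero_of_reflectionCovariant zerothMoment_eq_zero_of_reflectionCovariant)
open AffineAveraging (box toSite)
open AveragingMixedJetTables (vh₂SAt mixFFAt)
open AxialDressing (axDressK)
open BalabanStepW2 (T2Of)
open KernelReflection (tadpole_smul)
open Summit.QuantumFields.BalabanUV.Beta.GAN24.T2RecursionAffine (vsym)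
open Summit.QuantumFields.BalabanUV.Beta.GAN24.Lin4Additive (vsym_smul)
open Summit.QuantumFields.BalabanUV.Beta.MixedJetTablesPlug (JsBalAn1 hB_an1 hmix_an1)
open Summit.QuantumFields.BalabanUV.Gaps.D1PinnedResponseTowers (TbalOf_JsBalAn1_dataDiff T2Of_border_affine T2Of_dataDiff_universal)
open Summit.QuantumFields.BalabanUV.Gaps.D1IndexSymmetryDictionary (momentSummable_flipK_TbalOf)

namespace Summit.QuantumFields.BalabanUV.Gaps.D1WardPinsBorderWeight

/-! ## §1 Generic: zeroth moments of an affine pencil of kernels -/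

section Generic

variable {d : ℕ}

/-- [folklore] If `P = P₀ + c·U` entrywise and `P₀`, `U` have summable entries, then `m₀(P; a,b) = m₀(P₀; a,b) + c · m₀(U; a,b)`. -/
theorem zerothMoment_affine {P P₀ U : B12Beta.Kernel d} (h0 : MomentSummable P₀ 3) (hU : MomentSummable U 3) (c : ℝ) (hP : ∀ a b z, P a b z = P₀ a b z + c * U a b z)
    (a b : Fin d) : zerothMoment P a b = zerothMoment P₀ a b + c * zerothMoment U a b := by
  unfold OddMoments.zerothMoment
  rw [← tsum_mul_left, ← Summable.tsum_add (summable_self h0 a b) ((summable_self hU a b).mul_left c)]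
  exact tsum_congr fun z => hP a b z

/-- [folklore] The same for first moments. -/
theorem firstMoment_affine {P P₀ U : B12Beta.Kernel d} (h0 : MomentSummable P₀ 3) (hU : MomentSummable U 3) (c : ℝ) (hP : ∀ a b z, P a b z = P₀ a b z + c * U a b z)
    (a b γ : Fin d) : firstMoment P a b γ = firstMoment P₀ a b γ + c * firstMoment U a b γ := by
  unfold OddMoments.firstMoment
  rw [← tsum_mul_left, ← Summable.tsum_add (summable_mul_coord h0 a b γ) ((summable_mul_coord hU a b γ).mul_left c)]
  exact tsum_congr fun z => by rw [hP a b z]; ring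

/-- [folklore] Two roots of an affine function with a nonzero slope coincide; two DIFFERENT roots force slope and intercept to vanish. -/
theorem eq_zero_of_affine_pair {x₀ s c c' : ℝ} (hc : x₀ + c * s = 0) (hc' : x₀ + c' * s = 0) (hne : c ≠ c') : s = 0 ∧ x₀ = 0 := by
  have hs : (c - c') * s = 0 := by linarith
  have hs0 : s = 0 := by
    rcases mul_eq_zero.mp hs with h | h
    · exact absurd (sub_eq_zero.mp h) hne
    · exact h
  refine ⟨hs0, ?_⟩
  rw [hs0, mul_zero, add_zero] at hc
  exact hc

end Generic

/-! ## §2 The pinned family's step kernels are affine in the border weight, ENTRYWISE -/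

section Pinned

variable {Lc : ℕ} [NeZero Lc] {r : Fin (3 + 1) → ℕ}

/-- [folklore] **THE STEP KERNELS ARE AFFINE IN `cB`, ENTRY BY ENTRY** (every box root, colour triple, `cE₂`, table `T`, level `j`, indices, site):
`T_j(cB) μ ν z = T_j(0) μ ν z + cB · (T_j(1) μ ν z − T_j(0) μ ν z)` — GEN 12's `TbalOf_JsBalAn1_dataDiff` (two members with the same colour triple differ by the pure tadpole of the tower)
with the border tower `cB •` the unit one (`T2Of_border_affine` at an1's certified tables `hB_an1` ∕ `hmix_an1`), `vsym_smul`, `tadpole_smul`. -/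
theorem TbalOf_JsBalAn1_border_affine (hLc : 1 ≤ Lc) (hr : r ∈ box (3 + 1) Lc) (cE cVH cΛ cE₂ cB : ℝ) (T : Fin 4 → Fin 4 → Fin 4 → Fin 4 → ℝ) (j : ℕ) (μ ν : Fin 4) (z : Fin 4 → ℤ) :
    TbalOf Lc (JsBalAn1 hLc hr cE cVH cΛ cE₂ cB T) j μ ν z =
      TbalOf Lc (JsBalAn1 hLc hr cE cVH cΛ cE₂ 0 T) j μ ν z + cB * (TbalOf Lc (JsBalAn1 hLc hr cE cVH cΛ cE₂ 1 T) j μ ν z - TbalOf Lc (JsBalAn1 hLc hr cE cVH cΛ cE₂ 0 T) j μ ν z) := by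
  have hT := T2Of_border_affine (d := 3) (Lc := Lc) cE cVH cΛ cE₂ cB T hLc (hB_an1 hLc hr) (hmix_an1 hLc hr) j
  have hd := TbalOf_JsBalAn1_dataDiff hLc hr cE cVH cΛ cE₂ cB 0 T T j μ ν z
  have h1 := TbalOf_JsBalAn1_dataDiff hLc hr cE cVH cΛ cE₂ 1 0 T T j μ ν z
  rw [hT, vsym_smul, tadpole_smul] at hd
  rw [h1]
  linarith

/-- [folklore] The same for the FLIPPED kernels of the END's convention. -/
theorem flipK_TbalOf_JsBalAn1_border_affine (hLc : 1 ≤ Lc) (hr : r ∈ box (3 + 1) Lc) (cE cVH cΛ cE₂ cB : ℝ) (T : Fin 4 → Fin 4 → Fin 4 → Fin 4 → ℝ) (j : ℕ) (μ ν : Fin 4) (z : Fin 4 → ℤ) :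
    flipK (TbalOf Lc (JsBalAn1 hLc hr cE cVH cΛ cE₂ cB T) j) μ ν z =
      flipK (TbalOf Lc (JsBalAn1 hLc hr cE cVH cΛ cE₂ 0 T) j) μ ν z +
        cB * (fun a b w => flipK (TbalOf Lc (JsBalAn1 hLc hr cE cVH cΛ cE₂ 1 T) j) a b w - flipK (TbalOf Lc (JsBalAn1 hLc hr cE cVH cΛ cE₂ 0 T) j) a b w) μ ν z := by
  simp only [OneStepKernelFamily.flipK_apply]
  exact TbalOf_JsBalAn1_border_affine hLc hr cE cVH cΛ cE₂ cB T j μ ν (-z)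

/-- [folklore] **THE UNIT BORDER TOWER IS COLOUR-FREE, ENTRYWISE**: `T_j(c⃗; 1; T) − T_j(c⃗; 0; T) = T_j(c⃗′; 1; T) − T_j(c⃗′; 0; T)` for any two colour triples (GEN 12's
`T2Of_dataDiff_universal`: same recursion, same initial value; the dressing and the resolvent do not see `c⃗`).  So the slope of §3's affine Ward equation is ONE kernel per (root, `cE₂`,
table, level) — Engine C's border tower — for the whole colour space. -/
theorem unitBorder_colour_free (hLc : 1 ≤ Lc) (hr : r ∈ box (3 + 1) Lc) (cE cVH cΛ cE' cVH' cΛ' cE₂ : ℝ) (T : Fin 4 → Fin 4 → Fin 4 → Fin 4 → ℝ) (j : ℕ) (μ ν : Fin 4)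
    (z : Fin 4 → ℤ) :
    TbalOf Lc (JsBalAn1 hLc hr cE cVH cΛ cE₂ 1 T) j μ ν z - TbalOf Lc (JsBalAn1 hLc hr cE cVH cΛ cE₂ 0 T) j μ ν z =
      TbalOf Lc (JsBalAn1 hLc hr cE' cVH' cΛ' cE₂ 1 T) j μ ν z - TbalOf Lc (JsBalAn1 hLc hr cE' cVH' cΛ' cE₂ 0 T) j μ ν z := by
  rw [TbalOf_JsBalAn1_dataDiff hLc hr cE cVH cΛ cE₂ 1 0 T T j μ ν z, TbalOf_JsBalAn1_dataDiff hLc hr cE' cVH' cΛ' cE₂ 1 0 T T j μ ν z,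
    T2Of_dataDiff_universal (d := 3) (Lc := Lc) cE cVH cΛ cE₂ 1 0 T T hLc cE' cVH' cΛ' (hB_an1 hLc hr) (hmix_an1 hLc hr) j]

/-- [folklore] Summable moments of the UNIT BORDER TOWER `flipK T_j(1) − flipK T_j(0)` (difference of two members). -/
theorem momentSummable_unitBorder (hLc : 1 ≤ Lc) (hr : r ∈ box (3 + 1) Lc) (cE cVH cΛ cE₂ : ℝ) (T : Fin 4 → Fin 4 → Fin 4 → Fin 4 → ℝ) (j n : ℕ) :
    MomentSummable (fun a b w => flipK (TbalOf Lc (JsBalAn1 hLc hr cE cVH cΛ cE₂ 1 T) j) a b w - flipK (TbalOf Lc (JsBalAn1 hLc hr cE cVH cΛ cE₂ 0 T) j) a b w) n := by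
  intro a b
  have h := ((momentSummable_flipK_TbalOf (JsBalAn1 hLc hr cE cVH cΛ cE₂ 1 T) j n) a b).add ((momentSummable_flipK_TbalOf (JsBalAn1 hLc hr cE cVH cΛ cE₂ 0 T) j n) a b)
  refine Summable.of_nonneg_of_le (fun w => mul_nonneg (abs_nonneg _) (pow_nonneg (PolarizationSign.size_pos w).le _)) (fun w => ?_) h
  rw [← add_mul]
  exact mul_le_mul_of_nonneg_right (abs_sub _ _) (pow_nonneg (PolarizationSign.size_pos w).le _)

/-- [folklore] **EVERY ZEROTH MOMENT IS AFFINE IN THE BORDER WEIGHT**: `m₀(flipK T_j(cB); c,e) = m₀(flipK T_j(0); c,e) + cB · m₀(flipK T_j(1) − flipK T_j(0); c,e)`. -/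
theorem zerothMoment_flipK_TbalOf_JsBalAn1_border_affine (hLc : 1 ≤ Lc) (hr : r ∈ box (3 + 1) Lc) (cE cVH cΛ cE₂ cB : ℝ) (T : Fin 4 → Fin 4 → Fin 4 → Fin 4 → ℝ) (j : ℕ)
    (c e : Fin 4) :
    zerothMoment (flipK (TbalOf Lc (JsBalAn1 hLc hr cE cVH cΛ cE₂ cB T) j)) c e =
      zerothMoment (flipK (TbalOf Lc (JsBalAn1 hLc hr cE cVH cΛ cE₂ 0 T) j)) c e +
        cB * zerothMoment (fun a b w => flipK (TbalOf Lc (JsBalAn1 hLc hr cE cVH cΛ cE₂ 1 T) j) a b w - flipK (TbalOf Lc (JsBalAn1 hLc hr cE cVH cΛ cE₂ 0 T) j) a b w) c e :=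
  zerothMoment_affine (momentSummable_flipK_TbalOf _ j 3) (momentSummable_unitBorder hLc hr cE cVH cΛ cE₂ T j 3) cB
    (fun a b w => flipK_TbalOf_JsBalAn1_border_affine hLc hr cE cVH cΛ cE₂ cB T j a b w) c e

/-- [folklore] … and EVERY FIRST MOMENT is affine in the border weight (so the four parity-odd numbers of `Gaps/D1ParityOddFirstMoments` are affine in `cB` as well). -/
theorem firstMoment_flipK_TbalOf_JsBalAn1_border_affine (hLc : 1 ≤ Lc) (hr : r ∈ box (3 + 1) Lc) (cE cVH cΛ cE₂ cB : ℝ) (T : Fin 4 → Fin 4 → Fin 4 → Fin 4 → ℝ) (j : ℕ)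
    (c e γ : Fin 4) :
    firstMoment (flipK (TbalOf Lc (JsBalAn1 hLc hr cE cVH cΛ cE₂ cB T) j)) c e γ =
      firstMoment (flipK (TbalOf Lc (JsBalAn1 hLc hr cE cVH cΛ cE₂ 0 T) j)) c e γ +
        cB * firstMoment (fun a b w => flipK (TbalOf Lc (JsBalAn1 hLc hr cE cVH cΛ cE₂ 1 T) j) a b w - flipK (TbalOf Lc (JsBalAn1 hLc hr cE cVH cΛ cE₂ 0 T) j) a b w) c e γ :=
  firstMoment_affine (momentSummable_flipK_TbalOf _ j 3) (momentSummable_unitBorder hLc hr cE cVH cΛ cE₂ T j 3) cB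
    (fun a b w => flipK_TbalOf_JsBalAn1_border_affine hLc hr cE cVH cΛ cE₂ cB T j a b w) c e γ

/-! ## §3 Ward pins the border weight -/

/-- [folklore] **UNDER `hW` AT LEVEL `j`, THE BORDER WEIGHT SOLVES A LINEAR EQUATION PER CHANNEL**: `m₀(flipK T_j(0); c,e) + cB · m₀(unit border; c,e) = 0` for every `(c, e)` — the host's
`tsum_eq_zero_of_ward` on the member + §2. -/
theorem borderWeight_eq_of_ward (hLc : 1 ≤ Lc) (hr : r ∈ box (3 + 1) Lc) (cE cVH cΛ cE₂ cB : ℝ) (T : Fin 4 → Fin 4 → Fin 4 → Fin 4 → ℝ) (j : ℕ)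
    (hW : WardTransversal (flipK (TbalOf Lc (JsBalAn1 hLc hr cE cVH cΛ cE₂ cB T) j))) (c e : Fin 4) :
    zerothMoment (flipK (TbalOf Lc (JsBalAn1 hLc hr cE cVH cΛ cE₂ 0 T) j)) c e +
        cB * zerothMoment (fun a b w => flipK (TbalOf Lc (JsBalAn1 hLc hr cE cVH cΛ cE₂ 1 T) j) a b w - flipK (TbalOf Lc (JsBalAn1 hLc hr cE cVH cΛ cE₂ 0 T) j) a b w) c e = 0 := by
  rw [← zerothMoment_flipK_TbalOf_JsBalAn1_border_affine]
  exact tsum_eq_zero_of_ward (momentSummable_flipK_TbalOf _ j 3) hW c e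

/-- [folklore] **TWO DIFFERENT WARD-COMPATIBLE BORDER WEIGHTS AT ONE LEVEL KILL THE UNIT BORDER TOWER's ZEROTH MOMENTS** (and those of the member `cB = 0`): if `hW` holds at level `j` for
the members `cB` and `cB′ ≠ cB` (same root, colour triple, `cE₂`, table), then for every channel `m₀(flipK T_j(1) − flipK T_j(0); c,e) = 0` and `m₀(flipK T_j(0); c,e) = 0`. -/
theorem unitBorder_zerothMoment_eq_zero_of_ward_pair (hLc : 1 ≤ Lc) (hr : r ∈ box (3 + 1) Lc) (cE cVH cΛ cE₂ cB cB' : ℝ) (T : Fin 4 → Fin 4 → Fin 4 → Fin 4 → ℝ) (j : ℕ)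
    (hW : WardTransversal (flipK (TbalOf Lc (JsBalAn1 hLc hr cE cVH cΛ cE₂ cB T) j))) (hW' : WardTransversal (flipK (TbalOf Lc (JsBalAn1 hLc hr cE cVH cΛ cE₂ cB' T) j)))
    (hne : cB ≠ cB') (c e : Fin 4) :
    zerothMoment (fun a b w => flipK (TbalOf Lc (JsBalAn1 hLc hr cE cVH cΛ cE₂ 1 T) j) a b w - flipK (TbalOf Lc (JsBalAn1 hLc hr cE cVH cΛ cE₂ 0 T) j) a b w) c e = 0 ∧
      zerothMoment (flipK (TbalOf Lc (JsBalAn1 hLc hr cE cVH cΛ cE₂ 0 T) j)) c e = 0 :=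
  eq_zero_of_affine_pair (borderWeight_eq_of_ward hLc hr cE cVH cΛ cE₂ cB T j hW c e) (borderWeight_eq_of_ward hLc hr cE cVH cΛ cE₂ cB' T j hW' c e) hne

/-- [folklore] … hence EVERY member's zeroth moments vanish at that level: `hW` at TWO border weights ⟹ (T0) at ALL border weights (same other data, same level). -/
theorem zerothMoment_eq_zero_all_of_ward_pair (hLc : 1 ≤ Lc) (hr : r ∈ box (3 + 1) Lc) (cE cVH cΛ cE₂ cB cB' : ℝ) (T : Fin 4 → Fin 4 → Fin 4 → Fin 4 → ℝ) (j : ℕ)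
    (hW : WardTransversal (flipK (TbalOf Lc (JsBalAn1 hLc hr cE cVH cΛ cE₂ cB T) j))) (hW' : WardTransversal (flipK (TbalOf Lc (JsBalAn1 hLc hr cE cVH cΛ cE₂ cB' T) j)))
    (hne : cB ≠ cB') (cB'' : ℝ) (c e : Fin 4) : zerothMoment (flipK (TbalOf Lc (JsBalAn1 hLc hr cE cVH cΛ cE₂ cB'' T) j)) c e = 0 := by
  obtain ⟨hU, h0⟩ := unitBorder_zerothMoment_eq_zero_of_ward_pair hLc hr cE cVH cΛ cE₂ cB cB' T j hW hW' hne c e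
  rw [zerothMoment_flipK_TbalOf_JsBalAn1_border_affine, hU, h0, mul_zero, add_zero]

/-- [folklore] The unit border tower's zeroth moments are COLOUR-FREE (so the nonvanishing hypothesis below is ONE condition per (root, `cE₂`, table, level, channel) for all colour triples,
and the Ward-compatible border weight `cB*(c⃗)` of `borderWeight_formula_of_ward` has a colour-free denominator). -/
theorem unitBorder_zerothMoment_colour_free (hLc : 1 ≤ Lc) (hr : r ∈ box (3 + 1) Lc) (cE cVH cΛ cE' cVH' cΛ' cE₂ : ℝ) (T : Fin 4 → Fin 4 → Fin 4 → Fin 4 → ℝ) (j : ℕ)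
    (c e : Fin 4) :
    zerothMoment (fun a b w => flipK (TbalOf Lc (JsBalAn1 hLc hr cE cVH cΛ cE₂ 1 T) j) a b w - flipK (TbalOf Lc (JsBalAn1 hLc hr cE cVH cΛ cE₂ 0 T) j) a b w) c e =
      zerothMoment (fun a b w => flipK (TbalOf Lc (JsBalAn1 hLc hr cE' cVH' cΛ' cE₂ 1 T) j) a b w - flipK (TbalOf Lc (JsBalAn1 hLc hr cE' cVH' cΛ' cE₂ 0 T) j) a b w) c e := by
  unfold OddMoments.zerothMoment
  refine tsum_congr fun w => ?_
  simp only [OneStepKernelFamily.flipK_apply]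
  exact unitBorder_colour_free hLc hr cE cVH cΛ cE' cVH' cΛ' cE₂ T j c e (-w)

/-- [folklore] **WARD PINS THE BORDER WEIGHT**: if at level `j` the unit border tower has a NONZERO zeroth moment in some channel `(c, e)` (Engine C's float reading at `Lc = 3`, root
`ctrOff 4 3`, level 0, channel (0,1): `Σ_z P₀(z) = −1.2018e-8` — SIGMA-T1 §3.2; zero weight, NOT a hypothesis here but the intended instance), then AT MOST ONE border weight per
`(r; c⃗; cE₂; T)` admits the Ward binder `hW` at level `j` — and by `borderWeight_eq_of_ward` it is `cB = −m₀(flipK T_j(0); c,e) ∕ m₀(unit border; c,e)`. -/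
theorem borderWeight_unique_of_ward (hLc : 1 ≤ Lc) (hr : r ∈ box (3 + 1) Lc) (cE cVH cΛ cE₂ cB cB' : ℝ) (T : Fin 4 → Fin 4 → Fin 4 → Fin 4 → ℝ) (j : ℕ) {c e : Fin 4}
    (hU : zerothMoment (fun a b w => flipK (TbalOf Lc (JsBalAn1 hLc hr cE cVH cΛ cE₂ 1 T) j) a b w - flipK (TbalOf Lc (JsBalAn1 hLc hr cE cVH cΛ cE₂ 0 T) j) a b w) c e ≠ 0)
    (hW : WardTransversal (flipK (TbalOf Lc (JsBalAn1 hLc hr cE cVH cΛ cE₂ cB T) j))) (hW' : WardTransversal (flipK (TbalOf Lc (JsBalAn1 hLc hr cE cVH cΛ cE₂ cB' T) j))) :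
    cB = cB' := by
  by_contra hne
  exact hU (unitBorder_zerothMoment_eq_zero_of_ward_pair hLc hr cE cVH cΛ cE₂ cB cB' T j hW hW' hne c e).1

/-- [folklore] The explicit value: under `hW` at level `j` and a nonzero unit-border zeroth moment in channel `(c,e)`, `cB = −m₀(flipK T_j(0); c,e) ∕ m₀(unit border; c,e)`. -/
theorem borderWeight_formula_of_ward (hLc : 1 ≤ Lc) (hr : r ∈ box (3 + 1) Lc) (cE cVH cΛ cE₂ cB : ℝ) (T : Fin 4 → Fin 4 → Fin 4 → Fin 4 → ℝ) (j : ℕ) {c e : Fin 4}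
    (hU : zerothMoment (fun a b w => flipK (TbalOf Lc (JsBalAn1 hLc hr cE cVH cΛ cE₂ 1 T) j) a b w - flipK (TbalOf Lc (JsBalAn1 hLc hr cE cVH cΛ cE₂ 0 T) j) a b w) c e ≠ 0)
    (hW : WardTransversal (flipK (TbalOf Lc (JsBalAn1 hLc hr cE cVH cΛ cE₂ cB T) j))) :
    cB = -(zerothMoment (flipK (TbalOf Lc (JsBalAn1 hLc hr cE cVH cΛ cE₂ 0 T) j)) c e) /
        zerothMoment (fun a b w => flipK (TbalOf Lc (JsBalAn1 hLc hr cE cVH cΛ cE₂ 1 T) j) a b w - flipK (TbalOf Lc (JsBalAn1 hLc hr cE cVH cΛ cE₂ 0 T) j) a b w) c e := by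
  have h := borderWeight_eq_of_ward hLc hr cE cVH cΛ cE₂ cB T j hW c e
  field_simp
  linarith

/-- [folklore] **CONSISTENCY ACROSS CHANNELS AND LEVELS** (what `hW` for ONE member at ALL levels entails): the ratios `−m₀(flipK T_j(0); c,e) ∕ m₀(unit border_j; c,e)` COINCIDE for all levels
`j` and channels `(c,e)` at which the unit border tower's zeroth moment is nonzero — they all equal the member's `cB`.  Stated for two such (level, channel) pairs. -/
theorem borderWeight_ratio_consistent_of_ward (hLc : 1 ≤ Lc) (hr : r ∈ box (3 + 1) Lc) (cE cVH cΛ cE₂ cB : ℝ) (T : Fin 4 → Fin 4 → Fin 4 → Fin 4 → ℝ)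
    (hW : ∀ j, WardTransversal (flipK (TbalOf Lc (JsBalAn1 hLc hr cE cVH cΛ cE₂ cB T) j))) {j j' : ℕ} {c e c' e' : Fin 4}
    (hU : zerothMoment (fun a b w => flipK (TbalOf Lc (JsBalAn1 hLc hr cE cVH cΛ cE₂ 1 T) j) a b w - flipK (TbalOf Lc (JsBalAn1 hLc hr cE cVH cΛ cE₂ 0 T) j) a b w) c e ≠ 0)
    (hU' : zerothMoment (fun a b w => flipK (TbalOf Lc (JsBalAn1 hLc hr cE cVH cΛ cE₂ 1 T) j') a b w - flipK (TbalOf Lc (JsBalAn1 hLc hr cE cVH cΛ cE₂ 0 T) j') a b w) c' e' ≠ 0) :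
    -(zerothMoment (flipK (TbalOf Lc (JsBalAn1 hLc hr cE cVH cΛ cE₂ 0 T) j)) c e) /
        zerothMoment (fun a b w => flipK (TbalOf Lc (JsBalAn1 hLc hr cE cVH cΛ cE₂ 1 T) j) a b w - flipK (TbalOf Lc (JsBalAn1 hLc hr cE cVH cΛ cE₂ 0 T) j) a b w) c e =
      -(zerothMoment (flipK (TbalOf Lc (JsBalAn1 hLc hr cE cVH cΛ cE₂ 0 T) j')) c' e') /
        zerothMoment (fun a b w => flipK (TbalOf Lc (JsBalAn1 hLc hr cE cVH cΛ cE₂ 1 T) j') a b w - flipK (TbalOf Lc (JsBalAn1 hLc hr cE cVH cΛ cE₂ 0 T) j') a b w) c' e' := by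
  rw [← borderWeight_formula_of_ward hLc hr cE cVH cΛ cE₂ cB T j hU (hW j), ← borderWeight_formula_of_ward hLc hr cE cVH cΛ cE₂ cB T j' hU' (hW j')]

/-! ## §4 The reflection binder pins the border weight too (through the first moments and the off-diagonal zeroth moments of the unit border tower) -/

/-- [folklore] Under `hR` (5.7) at level `j`: `m₁(flipK T_j(0); c,e,γ) + cB·m₁(unit border_j; c,e,γ) = 0` for EVERY `(c,e,γ)` (an1's `firstMoment_eq_zero_of_reflectionCovariant` + §2). -/
theorem borderWeight_firstMoment_eq_of_hR (hLc : 1 ≤ Lc) (hr : r ∈ box (3 + 1) Lc) (cE cVH cΛ cE₂ cB : ℝ) (T : Fin 4 → Fin 4 → Fin 4 → Fin 4 → ℝ) (j : ℕ)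
    (hR : AxisReflectionCovariant (flipK (TbalOf Lc (JsBalAn1 hLc hr cE cVH cΛ cE₂ cB T) j))) (c e γ : Fin 4) :
    firstMoment (flipK (TbalOf Lc (JsBalAn1 hLc hr cE cVH cΛ cE₂ 0 T) j)) c e γ +
        cB * firstMoment (fun a b w => flipK (TbalOf Lc (JsBalAn1 hLc hr cE cVH cΛ cE₂ 1 T) j) a b w - flipK (TbalOf Lc (JsBalAn1 hLc hr cE cVH cΛ cE₂ 0 T) j) a b w) c e γ = 0 := by
  rw [← firstMoment_flipK_TbalOf_JsBalAn1_border_affine]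
  exact firstMoment_eq_zero_of_reflectionCovariant hR c e γ

/-- [folklore] **REFLECTION PINS THE BORDER WEIGHT**: if at level `j` the unit border tower has a NONZERO first moment in some `(c,e,γ)` (Engine C's booking T5 (a) measures exactly these:
`m₁(S_j; μ,ν,γ) = i∂Ŝ_j∕∂k_γ(0)`), then AT MOST ONE border weight per (root; c⃗; cE₂; table) admits `hR` at level `j`, namely `cB = −m₁(flipK T_j(0); c,e,γ) ∕ m₁(unit border_j; c,e,γ)`. -/
theorem borderWeight_unique_of_hR (hLc : 1 ≤ Lc) (hr : r ∈ box (3 + 1) Lc) (cE cVH cΛ cE₂ cB cB' : ℝ) (T : Fin 4 → Fin 4 → Fin 4 → Fin 4 → ℝ) (j : ℕ) {c e γ : Fin 4}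
    (hU : firstMoment (fun a b w => flipK (TbalOf Lc (JsBalAn1 hLc hr cE cVH cΛ cE₂ 1 T) j) a b w - flipK (TbalOf Lc (JsBalAn1 hLc hr cE cVH cΛ cE₂ 0 T) j) a b w) c e γ ≠ 0)
    (hR : AxisReflectionCovariant (flipK (TbalOf Lc (JsBalAn1 hLc hr cE cVH cΛ cE₂ cB T) j)))
    (hR' : AxisReflectionCovariant (flipK (TbalOf Lc (JsBalAn1 hLc hr cE cVH cΛ cE₂ cB' T) j))) : cB = cB' := by
  by_contra hne
  exact hU (eq_zero_of_affine_pair (borderWeight_firstMoment_eq_of_hR hLc hr cE cVH cΛ cE₂ cB T j hR c e γ)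
    (borderWeight_firstMoment_eq_of_hR hLc hr cE cVH cΛ cE₂ cB' T j hR' c e γ) hne).1

/-- [folklore] … and two DIFFERENT `hR`-compatible border weights at one level force EVERY first moment of the unit border tower (Engine C's parity-odd AND in-plane first derivatives of the
border-tower symbol at `k = 0`) and every OFF-diagonal zeroth moment of it to vanish there. -/
theorem unitBorder_firstMoment_eq_zero_of_hR_pair (hLc : 1 ≤ Lc) (hr : r ∈ box (3 + 1) Lc) (cE cVH cΛ cE₂ cB cB' : ℝ) (T : Fin 4 → Fin 4 → Fin 4 → Fin 4 → ℝ) (j : ℕ)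
    (hR : AxisReflectionCovariant (flipK (TbalOf Lc (JsBalAn1 hLc hr cE cVH cΛ cE₂ cB T) j)))
    (hR' : AxisReflectionCovariant (flipK (TbalOf Lc (JsBalAn1 hLc hr cE cVH cΛ cE₂ cB' T) j))) (hne : cB ≠ cB') (c e γ : Fin 4) :
    firstMoment (fun a b w => flipK (TbalOf Lc (JsBalAn1 hLc hr cE cVH cΛ cE₂ 1 T) j) a b w - flipK (TbalOf Lc (JsBalAn1 hLc hr cE cVH cΛ cE₂ 0 T) j) a b w) c e γ = 0 ∧
      (c ≠ e → zerothMoment (fun a b w => flipK (TbalOf Lc (JsBalAn1 hLc hr cE cVH cΛ cE₂ 1 T) j) a b w - flipK (TbalOf Lc (JsBalAn1 hLc hr cE cVH cΛ cE₂ 0 T) j) a b w) c e = 0) := by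
  refine ⟨(eq_zero_of_affine_pair (borderWeight_firstMoment_eq_of_hR hLc hr cE cVH cΛ cE₂ cB T j hR c e γ)
    (borderWeight_firstMoment_eq_of_hR hLc hr cE cVH cΛ cE₂ cB' T j hR' c e γ) hne).1, fun hce => ?_⟩
  have h0 : ∀ cB'' : ℝ, AxisReflectionCovariant (flipK (TbalOf Lc (JsBalAn1 hLc hr cE cVH cΛ cE₂ cB'' T) j)) →
      zerothMoment (flipK (TbalOf Lc (JsBalAn1 hLc hr cE cVH cΛ cE₂ 0 T) j)) c e +
        cB'' * zerothMoment (fun a b w => flipK (TbalOf Lc (JsBalAn1 hLc hr cE cVH cΛ cE₂ 1 T) j) a b w - flipK (TbalOf Lc (JsBalAn1 hLc hr cE cVH cΛ cE₂ 0 T) j) a b w) c e = 0 :=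
    fun cB'' h => by rw [← zerothMoment_flipK_TbalOf_JsBalAn1_border_affine]; exact zerothMoment_eq_zero_of_reflectionCovariant h hce
  exact (eq_zero_of_affine_pair (h0 cB hR) (h0 cB' hR') hne).1

end Pinned

end Summit.QuantumFields.BalabanUV.Gaps.D1WardPinsBorderWeight

end
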